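import Summits.BirchSwinnertonDyer.BirchSwinnertonDyer.Theorems.KolyvaginRoadThreeSchneiderTamAtThreeHeightLogNumeratorExactPChecker
import HarnessLib

/-!
# «The height is the logarithm of the numerator» — part 6b: THE EXACT ROW CHECKER at `p ≥ 5`, REDUCED FORM
# (the logarithm's argument reduced modulo `p^{4k}`; rows cost `O(k·log p)` digits, not `O(N·log a)`)

HONEST FRAMING (cell `bsd-stepL`, seat `bsd-stepL-tam3-p2` g5, WIDTH-LEVER second lane «closed-form Schneider
local factor … by Kodaira type (finite case table proved once)»; `--supports stmt-BirchSwinnertonDyer-19154 --as helper`):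
THEOREMS ONLY; 0 definitions, 0 named facts, 0 sorry; ONE curve per application; nothing class-wide; Schneider's
conjecture and BSD asserted nowhere. Route-free. Same checker as part 6 (`…ExactPChecker`), with ONE change that
makes the rows of the carrier-forced points cheap: the truncated logarithm is evaluated at ANY integer `A'` with
`p^{4k} ∣ (a^{p−1} − 1) − A'` (so `A'` may be the residue of `a^{p−1} − 1` modulo `p^{4k}`, a number of `4k` digits in
base `p` — at TR5 of crux 19624 the unreduced `SL` has 16 187 decimal digits, the reduced one `< 80`):
`‖log_p(1 + A) − log_p(1 + A')‖ ≤ ‖A − A'‖` (`norm_padicLog_one_add_sub_padicLog_one_add_le_padic`).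

* `norm_padicLog_one_add_sub_padicLog_one_add_le_padic` — `‖log_p(1+A) − log_p(1+A')‖_p ≤ ‖A − A'‖_p` on `‖A‖, ‖A'‖ ≤ p⁻¹`;
* `heightFourOneCoord_ne_zero_of_exactRowRed_padic`, `certNonsplit_of_exactRowRed_padic`,
  `regulatorNonvanishingAt_of_exactRowRed_padic` — as in part 6 with `A'` in place of `A = a^{p−1} − 1`.

References: [SteinWuthrich2013] §4.2, Conj. 4.1; [SilvermanAEC2009] VII.2.1; [Iwasawa1972PadicL] §4.4; tree: part 6.
-/

noncomputable section

open scoped Classical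
open Filter Topology IsUltrametricDist
open WeierstrassCurve Literature.NumberTheory.EllipticCurves
open Literature.NumberTheory.EllipticCurves.SteinWuthrich2013
open Literature.NumberTheory.EllipticCurves.TateCurve
open Literature.NumberTheory.EllipticCurves.Rank1Residual
open Summit.BirchSwinnertonDyer.Uniform.UI.O2
open Summit.BirchSwinnertonDyer.Rank1Residual Summit.BirchSwinnertonDyer.Rank1Residual.X11b
open Summit.BirchSwinnertonDyer.BirchSwinnertonDyer.Rank1Residual

namespace Summit.BirchSwinnertonDyer.Rank1Residual.X11b.RegMult.HeightLogNumerator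

variable {p : ℕ} [hp : Fact p.Prime]

/-! ### §17 The exact row checker, reduced form -/

section CheckerRed

/-- **`‖log_p(1 + A) − log_p(1 + A')‖_p ≤ ‖A − A'‖_p`** for `‖A‖, ‖A'‖ ≤ p⁻¹` (`p` odd):
`log_p((1+A)/(1+A')) = log_p(1 + t)`, `t = (A − A')/(1 + A')`, `‖t‖ = ‖A − A'‖`, `‖log_p(1+t)‖ ≤ ‖t‖`.
[cite: Iwasawa1972PadicL, §4.4] -/
theorem norm_padicLog_one_add_sub_padicLog_one_add_le_padic (hp2 : p ≠ 2) {A A' : ℚ_[p]}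
    (hA : ‖A‖ ≤ (p : ℝ)⁻¹) (hA' : ‖A'‖ ≤ (p : ℝ)⁻¹) :
    ‖padicLog p (1 + A) - padicLog p (1 + A')‖ ≤ ‖A - A'‖ := by
  have hp1 : (1 : ℝ) < p := by exact_mod_cast hp.out.one_lt
  have hpi : (p : ℝ)⁻¹ < 1 := inv_lt_one_of_one_lt₀ hp1
  have hAlt : ‖A‖ < 1 := hA.trans_lt hpi
  have hA'lt : ‖A'‖ < 1 := hA'.trans_lt hpi
  have h1A : ‖1 + A‖ = 1 := norm_one_add_eq_one_of_norm_lt_one hAlt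
  have h1A' : ‖1 + A'‖ = 1 := norm_one_add_eq_one_of_norm_lt_one hA'lt
  have h0 : 1 + A ≠ 0 := norm_pos_iff.mp (by rw [h1A]; exact one_pos)
  have h0' : 1 + A' ≠ 0 := norm_pos_iff.mp (by rw [h1A']; exact one_pos)
  set t : ℚ_[p] := (A - A') / (1 + A') with ht
  have htn : ‖t‖ = ‖A - A'‖ := by rw [ht, norm_div, h1A', div_one]
  have htlt : ‖t‖ < 1 := by
    rw [htn]; exact lt_of_le_of_lt (norm_sub_le_max₃ _ _) (max_lt hAlt hA'lt)
  have hmul : (1 + A) = (1 + t) * (1 + A') := by rw [ht]; field_simp; ring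
  have h1t0 : 1 + t ≠ 0 := by
    intro h; rw [h, zero_mul] at hmul; exact h0 hmul
  have e : padicLog p (1 + A) - padicLog p (1 + A') = padicLog p (1 + t) := by
    rw [hmul, padicLog_mul_holds p h1t0 h0']; ring
  rw [e]
  have hlog := Literature.NumberTheory.EllipticCurves.norm_padicLog_one_add_sub_le hp2 htlt
  have hle : ‖padicLog p (1 + t)‖ ≤ ‖t‖ := by
    rw [show padicLog p (1 + t) = (padicLog p (1 + t) - t) + t by ring]
    refine (norm_add_le_max _ _).trans (max_le (hlog.trans ?_) le_rfl)
    calc ‖t‖ ^ 2 = ‖t‖ * ‖t‖ := sq _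
      _ ≤ ‖t‖ * 1 := by gcongr
      _ = ‖t‖ := mul_one _
  rw [← htn]; exact hle

set_option maxHeartbeats 800000 in
/-- **THE EXACT ROW CHECKER at `p ≥ 5`, reduced form (value form).** As part 6, with the truncated logarithm taken at
any integer `A'` (here named `A`) with `p^{4k} ∣ a^{p−1} − 1 − A'`. See the module doc-string for the hypotheses; every one of
them is decided by `decide`/`norm_num` on ONE curve and ONE point, and the conclusion is the non-vanishing of the
Stein–Wuthrich (4.1) height `heightFourOneCoord W p q x y` for THE Tate parameter (any `q` with `‖q‖ < 1`,
`tateJ q = j`). Mechanism: `‖ĥ − T‖ ≤ p^{−4k}` for the rational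
`T = (p−1)⁻¹·SL/L + κ_n·(pᵏe')²/(c₄⁴a)` (exact law of part 4 + `κ`-proxy and truncated log of part 5), and
`T·(p−1)L c₄⁴ a = M` with `‖(p−1)L c₄⁴a‖ = p^{−w}`, so `p^{4k+w} ∤ M` forces `‖T‖ > p^{−4k}`.
[cite: SteinWuthrich2013, §4.2] [cite: SilvermanATAEC1994, Lemma V.5.1] [cite: Iwasawa1972PadicL, §4.4] -/
theorem heightFourOneCoord_ne_zero_of_exactRowRed_padic (hp5 : 5 ≤ p) (W : WeierstrassCurve ℚ) {a₁ a₂ a₃ a₄ a₆ : ℤ}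
    (hW : W = ⟨a₁, a₂, a₃, a₄, a₆⟩) [W.IsElliptic] [W.IsGloballyMinimal] (hWm : Mult W p)
    {a c4 c6 D κn A SL L M : ℤ} {e' k N α w : ℕ}
    (H : ¬ p ∣ e' ∧ 1 ≤ k ∧ Nat.Coprime a.natAbs (p ^ k * e') ∧
      c4 = (a₁ ^ 2 + 4 * a₂) ^ 2 - 24 * (2 * a₄ + a₁ * a₃) ∧
      c6 = -(a₁ ^ 2 + 4 * a₂) ^ 3 + 36 * (a₁ ^ 2 + 4 * a₂) * (2 * a₄ + a₁ * a₃) - 216 * (a₃ ^ 2 + 4 * a₆) ∧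
      D = -(a₁ ^ 2 + 4 * a₂) ^ 2 * (a₁ ^ 2 * a₆ + 4 * a₂ * a₆ - a₁ * a₃ * a₄ + a₂ * a₃ ^ 2 - a₄ ^ 2) -
        8 * (2 * a₄ + a₁ * a₃) ^ 3 - 27 * (a₃ ^ 2 + 4 * a₆) ^ 2 +
        9 * (a₁ ^ 2 + 4 * a₂) * (2 * a₄ + a₁ * a₃) * (a₃ ^ 2 + 4 * a₆) ∧
      ¬ (p : ℤ) ∣ c4 ∧ (p : ℤ) ^ k ∣ D ∧
      κn = ((a₁ ^ 2 + 4 * a₂) * (2 * a₄ + a₁ * a₃) - 18 * (a₃ ^ 2 + 4 * a₆)) * c4 ^ 3 + 60 * c6 * D ∧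
      (p : ℤ) ^ (4 * k) ∣ a ^ (p - 1) - 1 - A ∧ (p : ℤ) ^ α ∣ A ∧ 1 ≤ α ∧ (N + 1) * p ^ (4 * k) ≤ p ^ ((N + 1) * α) ∧
      (p : ℤ) ^ w ∣ L ∧ ¬ (p : ℤ) ^ (w + 1) ∣ L ∧
      M = c4 ^ 4 * a * SL + (p - 1 : ℕ) * L * κn * ((p ^ k * e' : ℕ) : ℤ) ^ 2 ∧
      ¬ (p : ℤ) ^ (4 * k + w) ∣ M)
    (hSL : (SL : ℚ) = L * ∑ n ∈ Finset.range N, (-1) ^ n * (A : ℚ) ^ (n + 1) / ((n : ℚ) + 1))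
    {x y : ℚ} (hx : x = a / ((p ^ k * e' : ℕ) : ℚ) ^ 2) (hP : W.toAffine.Equation x y)
    {q : ℚ_[p]} (hq : ‖q‖ < 1) (hj : tateJ q = (W.j : ℚ_[p])) :
    heightFourOneCoord W p q x y ≠ 0 := by
  obtain ⟨hpe', hk, hcop, hc4, hc6, hD, hpc4, hkD, hκn, hA, hαA, hα1, hNα, hwL, hwL', hM, hcrit⟩ := H
  have hpP : p.Prime := Fact.out
  have hp2 : p ≠ 2 := by omega
  have hp1 : (1 : ℝ) < p := by exact_mod_cast hpP.one_lt
  have hp1' : (1 : ℝ) ≤ p := hp1.le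
  have hpR0 : (0 : ℝ) < p := by positivity
  have he'0 : e' ≠ 0 := by rintro rfl; exact hpe' (dvd_zero p)
  have he0 : (p ^ k * e' : ℕ) ≠ 0 := Nat.mul_ne_zero (pow_ne_zero _ hpP.ne_zero) he'0
  have hpe : p ∣ p ^ k * e' := dvd_mul_of_dvd_left (dvd_pow_self p (by omega)) _
  have h : W.toAffine.Nonsingular x y :=
    (WeierstrassCurve.Affine.equation_iff_nonsingular (W := W.toAffine)).mp hP
  have hx1 : 1 < ‖(x : ℚ_[p])‖ :=
    (one_lt_norm_ratCast_iff p x).mpr (KernelCert.padicValRat_x_neg he0 hx hcop hpe)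
  -- `p ∤ a`, `p ∤ L/p^w`-type facts
  have hpa : ¬ (p : ℤ) ∣ a := by
    intro hd
    have h1' : p ∣ a.natAbs := Int.natCast_dvd.mp hd
    have h2' : p ∣ Nat.gcd a.natAbs (p ^ k * e') := Nat.dvd_gcd h1' hpe
    rw [hcop] at h2'
    exact hpP.one_lt.ne' (Nat.dvd_one.mp h2')
  have han : ‖(a : ℚ_[p])‖ = 1 := BinaryQuartic.norm_intCast_eq_one hpa
  have ha0 : (a : ℚ_[p]) ≠ 0 := norm_pos_iff.mp (by rw [han]; exact one_pos)
  have hc4n : ‖(c4 : ℚ_[p])‖ = 1 := BinaryQuartic.norm_intCast_eq_one hpc4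
  have hc40 : (c4 : ℚ_[p]) ≠ 0 := norm_pos_iff.mp (by rw [hc4n]; exact one_pos)
  have hLn : ‖(L : ℚ_[p])‖ = (p : ℝ) ^ (-(w : ℤ)) := GaloisImage.PadicSquareClass.norm_intCast_padic_eq hwL hwL'
  have hL0 : (L : ℚ_[p]) ≠ 0 := norm_pos_iff.mp (by rw [hLn]; positivity)
  have hp1n : ‖((p : ℚ_[p]) - 1)‖ = 1 := by
    rw [show (p : ℚ_[p]) - 1 = ((p - 1 : ℕ) : ℚ_[p]) by rw [Nat.cast_sub hpP.one_le, Nat.cast_one]]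
    exact Padic.norm_natCast_eq_one_iff.mpr ((Nat.coprime_self_sub_right hpP.one_le).mpr (Nat.coprime_one_right _))
  have hp10 : (p : ℚ_[p]) - 1 ≠ 0 := norm_pos_iff.mp (by rw [hp1n]; exact one_pos)
  -- `num x = a` and `‖x‖⁻¹ = p^{−2k}`
  set e : ℕ := p ^ k * e' with hedef
  have hcop2 : Nat.Coprime a.natAbs (((e : ℤ) ^ 2).natAbs) := by
    rw [Int.natAbs_pow, Int.natAbs_natCast]; exact hcop.pow_right 2
  have he2pos : (0 : ℤ) < (e : ℤ) ^ 2 := by positivity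
  have hxq : x = ((a : ℤ) : ℚ) / (((e : ℤ) ^ 2 : ℤ) : ℚ) := by rw [hx]; push_cast; ring
  have hnum : x.num = a := by rw [hxq]; exact Rat.num_div_eq_of_coprime he2pos hcop2
  have he'n : ‖(e' : ℚ_[p])‖ = 1 := by
    rw [show (e' : ℚ_[p]) = ((e' : ℤ) : ℚ_[p]) by norm_cast]
    exact BinaryQuartic.norm_intCast_eq_one (fun hd => hpe' (by exact_mod_cast hd))
  have hxp : (x : ℚ_[p]) = (a : ℚ_[p]) / ((p : ℚ_[p]) ^ k * (e' : ℚ_[p])) ^ 2 := by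
    rw [hx, hedef]; push_cast; ring
  have hxinv : ‖(x : ℚ_[p])‖⁻¹ = (p : ℝ) ^ (-((2 * k : ℕ) : ℤ)) := by
    rw [hxp, norm_div, han, norm_pow, norm_mul, norm_pow, Padic.norm_p, he'n,
      mul_one, one_div, inv_inv, ← zpow_natCast, ← zpow_natCast, ← zpow_mul, inv_zpow']
    congr 1; push_cast; ring
  have hX0 : (x : ℚ_[p]) ≠ 0 := norm_pos_iff.mp (one_pos.trans hx1)
  have hdn : (((x.den : ℚ) : ℚ_[p])) / (((x.num : ℚ) : ℚ_[p])) = ((x : ℚ_[p]))⁻¹ := by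
    have hd0 : ((x.den : ℚ) : ℚ_[p]) ≠ 0 := by exact_mod_cast x.den_nz
    have hnd : ((x.num : ℚ) : ℚ_[p]) = (x : ℚ_[p]) * ((x.den : ℚ) : ℚ_[p]) := by
      rw [← Rat.cast_mul, Rat.mul_den_eq_num]
    rw [hnd]; field_simp
  -- the curve data in `ℚ_p`
  set V := W.baseChange ℚ_[p] with hVdef
  have hVb2 : V.b₂ = ((a₁ ^ 2 + 4 * a₂ : ℤ) : ℚ_[p]) := by
    have h1 : V.b₂ = ((W.b₂ : ℚ) : ℚ_[p]) := (map_b₂ W (algebraMap ℚ ℚ_[p])).trans (eq_ratCast _ _)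
    rw [h1]; subst hW; simp only [WeierstrassCurve.b₂]; push_cast; ring
  have hVb4 : V.b₄ = ((2 * a₄ + a₁ * a₃ : ℤ) : ℚ_[p]) := by
    have h1 : V.b₄ = ((W.b₄ : ℚ) : ℚ_[p]) := (map_b₄ W (algebraMap ℚ ℚ_[p])).trans (eq_ratCast _ _)
    rw [h1]; subst hW; simp only [WeierstrassCurve.b₄]; push_cast; ring
  have hVb6 : V.b₆ = ((a₃ ^ 2 + 4 * a₆ : ℤ) : ℚ_[p]) := by
    have h1 : V.b₆ = ((W.b₆ : ℚ) : ℚ_[p]) := (map_b₆ W (algebraMap ℚ ℚ_[p])).trans (eq_ratCast _ _)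
    rw [h1]; subst hW; simp only [WeierstrassCurve.b₆]; push_cast; ring
  have hWc4Q : W.c₄ = (c4 : ℚ) := by
    subst hW; rw [hc4]; simp only [WeierstrassCurve.c₄, WeierstrassCurve.b₂, WeierstrassCurve.b₄]; push_cast; ring
  have hWc6Q : W.c₆ = (c6 : ℚ) := by
    subst hW; rw [hc6]
    simp only [WeierstrassCurve.c₆, WeierstrassCurve.b₂, WeierstrassCurve.b₄, WeierstrassCurve.b₆]; push_cast; ring
  have hWc4 : (W.c₄ : ℚ_[p]) = (c4 : ℚ_[p]) := by rw [hWc4Q]; push_cast; rfl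
  have hVc4 : V.c₄ = (c4 : ℚ_[p]) := by
    have h1 : V.c₄ = ((W.c₄ : ℚ) : ℚ_[p]) := (map_c₄ W (algebraMap ℚ ℚ_[p])).trans (eq_ratCast _ _)
    rw [h1, hWc4Q]; push_cast; rfl
  have hVc6 : V.c₆ = (c6 : ℚ_[p]) := by
    have h1 : V.c₆ = ((W.c₆ : ℚ) : ℚ_[p]) := (map_c₆ W (algebraMap ℚ ℚ_[p])).trans (eq_ratCast _ _)
    rw [h1, hWc6Q]; push_cast; rfl
  have hWΔ : (W.Δ : ℚ_[p]) = (D : ℚ_[p]) := by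
    have : W.Δ = (D : ℚ) := by
      subst hW; rw [hD]
      simp only [WeierstrassCurve.Δ, WeierstrassCurve.b₂, WeierstrassCurve.b₄, WeierstrassCurve.b₆,
        WeierstrassCurve.b₈]; push_cast; ring
    rw [this]; push_cast; rfl
  have hjinv : ((W.j : ℚ_[p]))⁻¹ = (D : ℚ_[p]) / (c4 : ℚ_[p]) ^ 3 := by
    have h1 : W.j = W.c₄ ^ 3 / W.Δ := by
      rw [WeierstrassCurve.j, ← WeierstrassCurve.coe_Δ', Units.val_inv_eq_inv_val]; ring
    have hjeq : (W.j : ℚ_[p]) = (W.c₄ : ℚ_[p]) ^ 3 / (W.Δ : ℚ_[p]) := by rw [h1]; push_cast; rfl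
    rw [hjeq, hWc4, hWΔ, inv_div]
  -- `‖q‖ ≤ p^{−k}` from `‖q‖ = ‖1/j‖ = ‖Δ‖/‖c₄‖³` and `p^k ∣ Δ`
  have hqn : ‖q‖ ≤ (p : ℝ) ^ (-(k : ℤ)) := by
    have e1 : ‖q‖ = ‖((W.j : ℚ_[p]))⁻¹‖ := by rw [norm_inv, ← hj, norm_tateJ_eq hq, inv_inv]
    rw [e1, hjinv, norm_div, norm_pow, hc4n, one_pow, div_one]
    exact_mod_cast (Padic.norm_int_le_pow_iff_dvd D k).mpr hkD
  -- (1) the exact law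
  have hlaw := norm_heightFourOneCoord_sub_padicLog_num_add_kappaE_mul_le_padic hp5 hWm hq h hx1
  rw [hdn, hxinv] at hlaw
  -- (2) the `κ`-proxy
  have hκ := norm_kappaE_add_kappa₀_add_j_le_padic hp5 hWm hq hj
  rw [← hVdef] at hκ hlaw
  have hκval : (V.b₂ * V.b₄ - 18 * V.b₆) / V.c₄ + 60 * (V.c₆ / V.c₄) * ((W.j : ℚ_[p]))⁻¹ =
      (κn : ℚ_[p]) / (c4 : ℚ_[p]) ^ 4 := by
    rw [hjinv, hVb2, hVb4, hVb6, hVc4, hVc6, hκn, eq_div_iff (pow_ne_zero 4 hc40)]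
    push_cast
    field_simp
  -- (3) the truncated logarithm
  -- the logarithm at the REDUCED argument `A`: `‖log_p a − (p−1)⁻¹ S_N(A)‖ ≤ max(p^{−4k}, (N+1)‖A‖^{N+1})`
  have hAn : ‖(A : ℚ_[p])‖ ≤ (p : ℝ) ^ (-(α : ℤ)) := by exact_mod_cast (Padic.norm_int_le_pow_iff_dvd A α).mpr hαA
  have hAp : ‖(A : ℚ_[p])‖ ≤ (p : ℝ)⁻¹ := hAn.trans (by
    rw [← zpow_neg_one]
    exact zpow_le_zpow_right₀ hp1' (by omega))
  set A0 : ℚ_[p] := ((a : ℚ_[p])) ^ (p - 1) - 1 with hA0def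
  have hA0int : A0 = ((a ^ (p - 1) - 1 : ℤ) : ℚ_[p]) := by rw [hA0def]; push_cast; ring
  have hA0p : ‖A0‖ ≤ (p : ℝ)⁻¹ := by
    have hlt : ‖A0‖ < 1 := by
      rw [hA0def]; exact norm_pow_sub_one_lt_one_of_norm_eq_one han
    rw [hA0int] at hlt ⊢
    have hdvd : (p : ℤ) ∣ a ^ (p - 1) - 1 := Padic.norm_intCast_lt_one_iff.mp hlt
    have h := (Padic.norm_int_le_pow_iff_dvd (a ^ (p - 1) - 1) 1).mpr (by simpa using hdvd)
    simpa using h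
  have hAA : ‖A0 - (A : ℚ_[p])‖ ≤ (p : ℝ) ^ (-((4 * k : ℕ) : ℤ)) := by
    rw [hA0int, show (((a ^ (p - 1) - 1 : ℤ)) : ℚ_[p]) - (A : ℚ_[p]) = ((a ^ (p - 1) - 1 - A : ℤ) : ℚ_[p]) by
      push_cast; ring]
    exact_mod_cast (Padic.norm_int_le_pow_iff_dvd (a ^ (p - 1) - 1 - A) (4 * k)).mpr hA
  -- `log_p a = (p−1)⁻¹ log_p(1 + A0)` (Iwasawa normalisation, `v_p(a) = 0`)
  have hval : (a : ℚ_[p]).valuation = 0 := by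
    have h := Padic.norm_eq_zpow_neg_valuation ha0
    rw [han] at h
    have h' : (p : ℝ) ^ (0 : ℤ) = (p : ℝ) ^ (-(a : ℚ_[p]).valuation) := by rw [zpow_zero]; exact h
    have := zpow_right_injective₀ (by positivity) hp1.ne' h'
    omega
  have h1A0 : (1 : ℚ_[p]) + A0 = ((a : ℚ_[p])) ^ (p - 1) := by rw [hA0def]; ring
  have hy1 : ‖1 - ((a : ℚ_[p])) ^ (p - 1)‖ < 1 := by
    rw [norm_sub_rev]; exact norm_pow_sub_one_lt_one_of_norm_eq_one han
  have hloga : padicLog p (a : ℚ_[p]) = ((p : ℚ_[p]) - 1)⁻¹ * padicLog p (1 + A0) := by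
    rw [h1A0, padicLog_eq_padicLogSeries hy1, padicLog_of_ne_zero ha0, hval, neg_zero, zpow_zero, mul_one]
  have hp1i : ‖((p : ℚ_[p]) - 1)⁻¹‖ = 1 := by rw [norm_inv, hp1n, inv_one]
  have hlog : ‖padicLog p (a : ℚ_[p]) - ((p : ℚ_[p]) - 1)⁻¹ *
      ∑ n ∈ Finset.range N, (-1) ^ n * ((A : ℚ_[p])) ^ (n + 1) / ((n : ℚ_[p]) + 1)‖ ≤
      max ((p : ℝ) ^ (-((4 * k : ℕ) : ℤ))) ((N + 1) * ‖(A : ℚ_[p])‖ ^ (N + 1)) := by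
    have htr := norm_padicLog_one_add_sub_sum_le_padic N hAp
    have hdl := norm_padicLog_one_add_sub_padicLog_one_add_le_padic hp2 hA0p hAp
    rw [hloga, ← mul_sub, show padicLog p (1 + A0) -
        ∑ n ∈ Finset.range N, (-1) ^ n * ((A : ℚ_[p])) ^ (n + 1) / ((n : ℚ_[p]) + 1) =
        (padicLog p (1 + A0) - padicLog p (1 + (A : ℚ_[p]))) +
        (padicLog p (1 + (A : ℚ_[p])) - ∑ n ∈ Finset.range N, (-1) ^ n * ((A : ℚ_[p])) ^ (n + 1) / ((n : ℚ_[p]) + 1))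
        by ring, norm_mul, hp1i, one_mul]
    exact (norm_add_le_max _ _).trans (max_le_max (hdl.trans hAA) htr)
  have hSLp : ((SL : ℚ_[p])) = (L : ℚ_[p]) *
      ∑ n ∈ Finset.range N, (-1) ^ n * ((A : ℚ_[p])) ^ (n + 1) / ((n : ℚ_[p]) + 1) := by
    have hc := congrArg (fun t : ℚ => (t : ℚ_[p])) hSL
    simpa [Rat.cast_sum] using hc
  have hsum : ∑ n ∈ Finset.range N, (-1) ^ n * ((A : ℚ_[p])) ^ (n + 1) / ((n : ℚ_[p]) + 1) =
      (SL : ℚ_[p]) / (L : ℚ_[p]) := by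
    rw [hSLp]; field_simp
  rw [hsum] at hlog
  -- the rational `T` and the identity `T · ((p−1) L c₄⁴ a) = M`
  set T : ℚ_[p] := ((p : ℚ_[p]) - 1)⁻¹ * ((SL : ℚ_[p]) / (L : ℚ_[p])) +
    (κn : ℚ_[p]) / (c4 : ℚ_[p]) ^ 4 * ((x : ℚ_[p]))⁻¹ with hTdef
  have hTM : T * (((p : ℚ_[p]) - 1) * (L : ℚ_[p]) * (c4 : ℚ_[p]) ^ 4 * (a : ℚ_[p])) = (M : ℚ_[p]) := by
    have he'Q : (e' : ℚ_[p]) ≠ 0 := by exact_mod_cast he'0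
    have hpQ : (p : ℚ_[p]) ≠ 0 := by exact_mod_cast hpP.ne_zero
    rw [hTdef, hM, hxp, hedef]; push_cast
    rw [Nat.cast_sub hpP.one_le, Nat.cast_one]
    field_simp
  -- `‖ĥ − T‖ ≤ p^{−4k}`
  have h4k : ((p : ℝ) ^ (-((2 * k : ℕ) : ℤ))) ^ 2 = (p : ℝ) ^ (-((4 * k : ℕ) : ℤ)) := by
    rw [← zpow_natCast, ← zpow_mul]; congr 1; push_cast; ring
  have hdiff : ‖heightFourOneCoord W p q x y - T‖ ≤ (p : ℝ) ^ (-((4 * k : ℕ) : ℤ)) := by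
    have e1 : heightFourOneCoord W p q x y - T =
        (heightFourOneCoord W p q x y - padicLog p ((x.num : ℚ) : ℚ_[p]) +
          ((uniformisationScaleSq W p q)⁻¹ * (1 - 24 * tateS 1 q) - V.b₂) / 12 * ((x : ℚ_[p]))⁻¹) +
        (padicLog p ((x.num : ℚ) : ℚ_[p]) - ((p : ℚ_[p]) - 1)⁻¹ * ((SL : ℚ_[p]) / (L : ℚ_[p]))) -
        (((uniformisationScaleSq W p q)⁻¹ * (1 - 24 * tateS 1 q) - V.b₂) / 12 +
          (V.b₂ * V.b₄ - 18 * V.b₆) / V.c₄ + 60 * (V.c₆ / V.c₄) * ((W.j : ℚ_[p]))⁻¹) * ((x : ℚ_[p]))⁻¹ := by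
      rw [hTdef, ← hκval]; ring
    rw [e1]
    refine (norm_sub_le_max₃ _ _).trans (max_le ((norm_add_le_max _ _).trans (max_le (hlaw.trans_eq h4k) ?_)) ?_)
    · rw [hnum, Rat.cast_intCast]
      refine hlog.trans (max_le le_rfl ?_)
      have key : ((N : ℝ) + 1) * ((p : ℝ) ^ ((N + 1) * α))⁻¹ ≤ ((p : ℝ) ^ (4 * k))⁻¹ := by
        rw [mul_inv_le_iff₀ (by positivity), inv_mul_eq_div, le_div_iff₀ (by positivity)]
        exact_mod_cast hNα
      calc ((N : ℝ) + 1) * ‖(A : ℚ_[p])‖ ^ (N + 1) ≤ ((N : ℝ) + 1) * ((p : ℝ) ^ (-(α : ℤ))) ^ (N + 1) := by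
            gcongr
        _ = ((N : ℝ) + 1) * ((p : ℝ) ^ ((N + 1) * α))⁻¹ := by
            rw [zpow_neg, zpow_natCast, inv_pow, ← pow_mul, mul_comm α]
        _ ≤ ((p : ℝ) ^ (4 * k))⁻¹ := key
        _ = (p : ℝ) ^ (-((4 * k : ℕ) : ℤ)) := by rw [zpow_neg, zpow_natCast]
    · rw [norm_mul, norm_inv, hxinv]
      calc ‖((uniformisationScaleSq W p q)⁻¹ * (1 - 24 * tateS 1 q) - V.b₂) / 12 +
            (V.b₂ * V.b₄ - 18 * V.b₆) / V.c₄ + 60 * (V.c₆ / V.c₄) * ((W.j : ℚ_[p]))⁻¹‖ *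
            (p : ℝ) ^ (-((2 * k : ℕ) : ℤ)) ≤ ‖q‖ ^ 2 * (p : ℝ) ^ (-((2 * k : ℕ) : ℤ)) := by gcongr
        _ ≤ ((p : ℝ) ^ (-(k : ℤ))) ^ 2 * (p : ℝ) ^ (-((2 * k : ℕ) : ℤ)) := by gcongr
        _ = (p : ℝ) ^ (-((4 * k : ℕ) : ℤ)) := by
            rw [← zpow_natCast, ← zpow_mul, ← zpow_add₀ hpR0.ne']; congr 1; push_cast; ring
  -- `‖T‖ > p^{−4k}` from `p^{4k+w} ∤ M`
  have hTn : ‖T‖ = ‖(M : ℚ_[p])‖ * (p : ℝ) ^ (w : ℤ) := by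
    have hden : ‖((p : ℚ_[p]) - 1) * (L : ℚ_[p]) * (c4 : ℚ_[p]) ^ 4 * (a : ℚ_[p])‖ = (p : ℝ) ^ (-(w : ℤ)) := by
      rw [norm_mul, norm_mul, norm_mul, hp1n, hLn, norm_pow, hc4n, han]; ring
    have hd0 : ((p : ℚ_[p]) - 1) * (L : ℚ_[p]) * (c4 : ℚ_[p]) ^ 4 * (a : ℚ_[p]) ≠ 0 :=
      norm_pos_iff.mp (by rw [hden]; positivity)
    have eT : T = (M : ℚ_[p]) / (((p : ℚ_[p]) - 1) * (L : ℚ_[p]) * (c4 : ℚ_[p]) ^ 4 * (a : ℚ_[p])) := by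
      rw [← hTM, mul_div_cancel_right₀ _ hd0]
    rw [eT, norm_div, hden, zpow_neg, div_inv_eq_mul]
  have hMgt : (p : ℝ) ^ (-((4 * k + w : ℕ) : ℤ)) < ‖(M : ℚ_[p])‖ := by
    by_contra hle
    exact hcrit ((Padic.norm_int_le_pow_iff_dvd M (4 * k + w)).mp (not_lt.mp hle))
  have hTgt : (p : ℝ) ^ (-((4 * k : ℕ) : ℤ)) < ‖T‖ := by
    rw [hTn]
    calc (p : ℝ) ^ (-((4 * k : ℕ) : ℤ)) = (p : ℝ) ^ (-((4 * k + w : ℕ) : ℤ)) * (p : ℝ) ^ (w : ℤ) := by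
          rw [← zpow_add₀ hpR0.ne']; congr 1; push_cast; ring
      _ < ‖(M : ℚ_[p])‖ * (p : ℝ) ^ (w : ℤ) := by gcongr
  -- conclusion
  intro h0
  rw [h0, zero_sub, norm_neg] at hdiff
  exact absurd hdiff (not_le.mpr hTgt)

/-- **THE EXACT ROW CHECKER in certificate currency**: with the gcd admissibility test
(`gcd(Φ_y(Q)·e³, Φ_x(Q)·e⁴) ∣ eⁿ`), `RegMult.CertNonsplit W p (x, y) 1`. ONE curve per application.
[cite: SteinWuthrich2013, §4.2] [cite: SilvermanAEC2009, VII.2.1] [cite: MazurSteinTate2006, §1] -/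
theorem certNonsplit_of_exactRowRed_padic (hp5 : 5 ≤ p) (W : WeierstrassCurve ℚ) {a₁ a₂ a₃ a₄ a₆ : ℤ}
    (hW : W = ⟨a₁, a₂, a₃, a₄, a₆⟩) [W.IsElliptic] [W.IsGloballyMinimal] (hWm : Mult W p)
    {a b c4 c6 D κn A SL L M : ℤ} {e' k n N α w : ℕ}
    (Hg : Int.gcd (2 * b + a₁ * a * (p ^ k * e' : ℕ) + a₃ * (p ^ k * e' : ℕ) ^ 3)
        (a₁ * b * (p ^ k * e' : ℕ) - (3 * a ^ 2 + 2 * a₂ * a * (p ^ k * e' : ℕ) ^ 2 + a₄ * (p ^ k * e' : ℕ) ^ 4))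
        ∣ (p ^ k * e') ^ n)
    (H : ¬ p ∣ e' ∧ 1 ≤ k ∧ Nat.Coprime a.natAbs (p ^ k * e') ∧
      c4 = (a₁ ^ 2 + 4 * a₂) ^ 2 - 24 * (2 * a₄ + a₁ * a₃) ∧
      c6 = -(a₁ ^ 2 + 4 * a₂) ^ 3 + 36 * (a₁ ^ 2 + 4 * a₂) * (2 * a₄ + a₁ * a₃) - 216 * (a₃ ^ 2 + 4 * a₆) ∧
      D = -(a₁ ^ 2 + 4 * a₂) ^ 2 * (a₁ ^ 2 * a₆ + 4 * a₂ * a₆ - a₁ * a₃ * a₄ + a₂ * a₃ ^ 2 - a₄ ^ 2) -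
        8 * (2 * a₄ + a₁ * a₃) ^ 3 - 27 * (a₃ ^ 2 + 4 * a₆) ^ 2 +
        9 * (a₁ ^ 2 + 4 * a₂) * (2 * a₄ + a₁ * a₃) * (a₃ ^ 2 + 4 * a₆) ∧
      ¬ (p : ℤ) ∣ c4 ∧ (p : ℤ) ^ k ∣ D ∧
      κn = ((a₁ ^ 2 + 4 * a₂) * (2 * a₄ + a₁ * a₃) - 18 * (a₃ ^ 2 + 4 * a₆)) * c4 ^ 3 + 60 * c6 * D ∧
      (p : ℤ) ^ (4 * k) ∣ a ^ (p - 1) - 1 - A ∧ (p : ℤ) ^ α ∣ A ∧ 1 ≤ α ∧ (N + 1) * p ^ (4 * k) ≤ p ^ ((N + 1) * α) ∧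
      (p : ℤ) ^ w ∣ L ∧ ¬ (p : ℤ) ^ (w + 1) ∣ L ∧
      M = c4 ^ 4 * a * SL + (p - 1 : ℕ) * L * κn * ((p ^ k * e' : ℕ) : ℤ) ^ 2 ∧
      ¬ (p : ℤ) ^ (4 * k + w) ∣ M)
    (hSL : (SL : ℚ) = L * ∑ n ∈ Finset.range N, (-1) ^ n * (A : ℚ) ^ (n + 1) / ((n : ℚ) + 1))
    {x y : ℚ} (hx : x = a / ((p ^ k * e' : ℕ) : ℚ) ^ 2) (hy : y = b / ((p ^ k * e' : ℕ) : ℚ) ^ 3)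
    (h : W.toAffine.Nonsingular x y) :
    RegMult.CertNonsplit W p (.some x y h) 1 := by
  have hpP : p.Prime := Fact.out
  have he'0 : e' ≠ 0 := by rintro rfl; exact H.1 (dvd_zero p)
  have he0 : (p ^ k * e' : ℕ) ≠ 0 := Nat.mul_ne_zero (pow_ne_zero _ hpP.ne_zero) he'0
  have hpe : p ∣ p ^ k * e' := dvd_mul_of_dvd_left (dvd_pow_self p (by have := H.2.1; omega)) _
  have hx1 : 1 < ‖(x : ℚ_[p])‖ :=
    (one_lt_norm_ratCast_iff p x).mpr (KernelCert.padicValRat_x_neg he0 hx H.2.2.1 hpe)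
  have hadm : W.IsAdmissible p (.some x y h) :=
    isAdmissible_of_one_lt_norm (by omega) h hx1
      (KernelCert.hasNonsingularReductionAt_of_gcd W hW he0 hx hy H.2.2.1 Hg)
  refine ⟨by rw [one_nsmul]; exact hadm, fun q _ hq hjq => ?_⟩
  rw [one_nsmul, heightFourOne_some]
  exact heightFourOneCoord_ne_zero_of_exactRowRed_padic hp5 W hW hWm H hSL hx h.left hq hjq

/-- **On a NON-split curve of Mordell–Weil rank one, ONE exact row gives `ClassClosure.RegulatorNonvanishingAt W p`**
(lane A's `RegMult.regulatorNonvanishingAt_of_cert_of_not_split`). CONDITIONAL on the rank (GZK supplies it on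
`ClassX11b`); Schneider's conjecture asserted nowhere. [cite: SteinWuthrich2013, §4.2, Conj. 4.1] -/
theorem regulatorNonvanishingAt_of_exactRowRed_padic (hp5 : 5 ≤ p) (W : WeierstrassCurve ℚ) {a₁ a₂ a₃ a₄ a₆ : ℤ}
    (hW : W = ⟨a₁, a₂, a₃, a₄, a₆⟩) [W.IsElliptic] [W.IsGloballyMinimal] (hWm : Mult W p)
    (hns : ¬ W.HasSplitMultiplicativeReductionAtPrime p) (hr : W.mordellWeilRank = 1)
    {a b c4 c6 D κn A SL L M : ℤ} {e' k n N α w : ℕ}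
    (Hg : Int.gcd (2 * b + a₁ * a * (p ^ k * e' : ℕ) + a₃ * (p ^ k * e' : ℕ) ^ 3)
        (a₁ * b * (p ^ k * e' : ℕ) - (3 * a ^ 2 + 2 * a₂ * a * (p ^ k * e' : ℕ) ^ 2 + a₄ * (p ^ k * e' : ℕ) ^ 4))
        ∣ (p ^ k * e') ^ n)
    (H : ¬ p ∣ e' ∧ 1 ≤ k ∧ Nat.Coprime a.natAbs (p ^ k * e') ∧
      c4 = (a₁ ^ 2 + 4 * a₂) ^ 2 - 24 * (2 * a₄ + a₁ * a₃) ∧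
      c6 = -(a₁ ^ 2 + 4 * a₂) ^ 3 + 36 * (a₁ ^ 2 + 4 * a₂) * (2 * a₄ + a₁ * a₃) - 216 * (a₃ ^ 2 + 4 * a₆) ∧
      D = -(a₁ ^ 2 + 4 * a₂) ^ 2 * (a₁ ^ 2 * a₆ + 4 * a₂ * a₆ - a₁ * a₃ * a₄ + a₂ * a₃ ^ 2 - a₄ ^ 2) -
        8 * (2 * a₄ + a₁ * a₃) ^ 3 - 27 * (a₃ ^ 2 + 4 * a₆) ^ 2 +
        9 * (a₁ ^ 2 + 4 * a₂) * (2 * a₄ + a₁ * a₃) * (a₃ ^ 2 + 4 * a₆) ∧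
      ¬ (p : ℤ) ∣ c4 ∧ (p : ℤ) ^ k ∣ D ∧
      κn = ((a₁ ^ 2 + 4 * a₂) * (2 * a₄ + a₁ * a₃) - 18 * (a₃ ^ 2 + 4 * a₆)) * c4 ^ 3 + 60 * c6 * D ∧
      (p : ℤ) ^ (4 * k) ∣ a ^ (p - 1) - 1 - A ∧ (p : ℤ) ^ α ∣ A ∧ 1 ≤ α ∧ (N + 1) * p ^ (4 * k) ≤ p ^ ((N + 1) * α) ∧
      (p : ℤ) ^ w ∣ L ∧ ¬ (p : ℤ) ^ (w + 1) ∣ L ∧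
      M = c4 ^ 4 * a * SL + (p - 1 : ℕ) * L * κn * ((p ^ k * e' : ℕ) : ℤ) ^ 2 ∧
      ¬ (p : ℤ) ^ (4 * k + w) ∣ M)
    (hSL : (SL : ℚ) = L * ∑ n ∈ Finset.range N, (-1) ^ n * (A : ℚ) ^ (n + 1) / ((n : ℚ) + 1))
    {x y : ℚ} (hx : x = a / ((p ^ k * e' : ℕ) : ℚ) ^ 2) (hy : y = b / ((p ^ k * e' : ℕ) : ℚ) ^ 3)
    (h : W.toAffine.Nonsingular x y) :
    ClassClosure.RegulatorNonvanishingAt W p :=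
  RegMult.regulatorNonvanishingAt_of_cert_of_not_split hr hns
    (certNonsplit_of_exactRowRed_padic hp5 W hW hWm Hg H hSL hx hy h)

end CheckerRed

end Summit.BirchSwinnertonDyer.Rank1Residual.X11b.RegMult.HeightLogNumerator

end
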